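import Literature.Probability.LatticeModels.SquareTilingModulusLimsup

/-!
# Fatou for the Dirichlet energy along arbitrary meshes and graphs
# (`∫∫_Ω ‖∇v‖² ≤ lim 𝓔(h_n)`, the lower-semicontinuity step of [GP19] §4.5)

Support file for `KirchhoffExtremalLength` (route CardyUSTContinuation of `CardyFormulaZ2`, item
stmt-CriticalPhenomena-11234), towards `G02ModulusConvergence` (`…Defs.lean`). The tree's
`SquareTiling.lintegral_level_le` / `lintegral_norm_fderiv_sq_le` prove the Fatou step along the
DYADIC meshes `2⁻ᵏ⁽ⁿ⁾` for the Georgakopoulos–Panagiotis graphs `domainGraph`, using that a level-`m`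
dyadic square is tiled exactly by the fine cells. Here the same statements are proved for an
arbitrary sequence of meshes `δ n → 0⁺` and an arbitrary sequence of subgraphs `G n` of `ℤ²`
(`lintegral_level_le'`, `lintegral_norm_fderiv_sq_le'`): at mesh `δ` the level-`m` square of
corner `ℓ a` (`ℓ = 2⁻ᵐ`) is replaced by the fine-aligned square of side `δ ⌊ℓ/δ⌋` and corner
`δ ⌊ℓ/δ⌋ a`, to which the one-mesh bookkeeping `SquareTiling.lintegral_squares_le_energy` applies
verbatim; the two squares differ by a set of measure `O(δ)` on which the integrand is bounded
(`volume_sq_diff_sq_le`), an error that vanishes in the limit.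
-/

noncomputable section

namespace Summit.CriticalPhenomena.CardyFormulaZ2.Theorems

namespace KirchhoffSlope

open Set Metric Filter Topology MeasureTheory
open scoped ENNReal NNReal
open Literature.Probability.LatticeModels Literature.Probability.LatticeModels.SquareTiling

variable {Ω : Set ℂ}

/-- The volume of a closed coordinate rectangle `[a, b] × [c, d]` in `ℂ` (`a ≤ b`). [folklore] -/
theorem volume_Icc_reProdIm_Icc {a b c d : ℝ} (hab : a ≤ b) :
    volume (Icc a b ×ℂ Icc c d) = ENNReal.ofReal ((b - a) * (d - c)) := by
  rw [Literature.Analysis.Complex.ExtremalLength.volume_reProdIm, Real.volume_Icc, Real.volume_Icc,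
    ← ENNReal.ofReal_mul (by linarith)]

/-- **Two nearly equal squares differ by a thin frame.** If the corner `(s₀, s₁)` of a half-open
square of side `L ≥ ℓ - d` is within `d` (coordinatewise) of the corner `(u₀, u₁)` of the
half-open square of side `ℓ`, then the part of the latter outside the former has area at most
`8 d ℓ`. [folklore] -/
theorem volume_sq_diff_sq_le {u₀ u₁ s₀ s₁ ℓ L d : ℝ} (hℓ : 0 ≤ ℓ) (hd : 0 ≤ d)
    (h0 : u₀ - d ≤ s₀) (h0' : s₀ ≤ u₀ + d) (h1 : u₁ - d ≤ s₁) (h1' : s₁ ≤ u₁ + d) (hL : ℓ - d ≤ L) :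
    volume ((Ico u₀ (u₀ + ℓ) ×ℂ Ico u₁ (u₁ + ℓ)) \ (Ico s₀ (s₀ + L) ×ℂ Ico s₁ (s₁ + L))) ≤
      ENNReal.ofReal (8 * d * ℓ) := by
  -- the four strips
  set S₁ : Set ℂ := Icc u₀ (u₀ + d) ×ℂ Icc u₁ (u₁ + ℓ) with hS₁
  set S₂ : Set ℂ := Icc (u₀ + ℓ - 2 * d) (u₀ + ℓ) ×ℂ Icc u₁ (u₁ + ℓ) with hS₂
  set S₃ : Set ℂ := Icc u₀ (u₀ + ℓ) ×ℂ Icc u₁ (u₁ + d) with hS₃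
  set S₄ : Set ℂ := Icc u₀ (u₀ + ℓ) ×ℂ Icc (u₁ + ℓ - 2 * d) (u₁ + ℓ) with hS₄
  have hsub : (Ico u₀ (u₀ + ℓ) ×ℂ Ico u₁ (u₁ + ℓ)) \ (Ico s₀ (s₀ + L) ×ℂ Ico s₁ (s₁ + L)) ⊆
      (S₁ ∪ S₂) ∪ (S₃ ∪ S₄) := by
    rintro w ⟨⟨⟨hw0, hw0'⟩, ⟨hw1, hw1'⟩⟩, hw⟩
    simp only [Complex.mem_reProdIm, mem_Ico, not_and_or, not_le] at hw
    rcases hw with (h | h) | (h | h)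
    · exact Or.inl (Or.inl ⟨⟨hw0, by linarith⟩, ⟨hw1, hw1'.le⟩⟩)
    · exact Or.inl (Or.inr ⟨⟨by linarith, hw0'.le⟩, ⟨hw1, hw1'.le⟩⟩)
    · exact Or.inr (Or.inl ⟨⟨hw0, hw0'.le⟩, ⟨hw1, by linarith⟩⟩)
    · exact Or.inr (Or.inr ⟨⟨hw0, hw0'.le⟩, ⟨by linarith, hw1'.le⟩⟩)
  have hv₁ : volume S₁ = ENNReal.ofReal (d * ℓ) := by
    rw [hS₁, volume_Icc_reProdIm_Icc (by linarith)]; congr 1; ring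
  have hv₂ : volume S₂ = ENNReal.ofReal (2 * d * ℓ) := by
    rw [hS₂, volume_Icc_reProdIm_Icc (by linarith)]; congr 1; ring
  have hv₃ : volume S₃ = ENNReal.ofReal (ℓ * d) := by
    rw [hS₃, volume_Icc_reProdIm_Icc (by linarith)]; congr 1; ring
  have hv₄ : volume S₄ = ENNReal.ofReal (ℓ * (2 * d)) := by
    rw [hS₄, volume_Icc_reProdIm_Icc (by linarith)]; congr 1; ring
  calc volume ((Ico u₀ (u₀ + ℓ) ×ℂ Ico u₁ (u₁ + ℓ)) \ (Ico s₀ (s₀ + L) ×ℂ Ico s₁ (s₁ + L)))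
      ≤ volume ((S₁ ∪ S₂) ∪ (S₃ ∪ S₄)) := measure_mono hsub
    _ ≤ (volume S₁ + volume S₂) + (volume S₃ + volume S₄) :=
        (measure_union_le _ _).trans (add_le_add (measure_union_le _ _) (measure_union_le _ _))
    _ = ENNReal.ofReal (d * ℓ + 2 * d * ℓ + (ℓ * d + ℓ * (2 * d))) := by
        rw [hv₁, hv₂, hv₃, hv₄, ← ENNReal.ofReal_add (by positivity) (by positivity),
          ← ENNReal.ofReal_add (by positivity) (by positivity), ← ENNReal.ofReal_add (by positivity) (by positivity)]
    _ ≤ ENNReal.ofReal (8 * d * ℓ) := ENNReal.ofReal_le_ofReal (by nlinarith)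

set_option maxHeartbeats 800000 in
open Classical in
/-- **Fatou on a finite family of level-`m` squares, arbitrary meshes and graphs**
([GP19], §4.5, `lim inf 𝓔(h_n) ≥ ∫∫ |∇h|²`, local form). Let `Ω` be open, `δ n → 0⁺` meshes,
`G n` subgraphs of `ℤ²` whose edge sets eventually contain all axis edges at the lattice points of
any compact subset of `Ω`, and `h n : ℤ² → ℝ` with `𝓔_{G n}(h n) ≤ C n → I`; assume the discrete
partial derivatives of `h n` converge locally uniformly on `Ω` to the partial derivatives of `v`,
whose derivative is continuous on `Ω`. Then for every finite set `𝒬` of level-`m` corners `a` with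
`B̄(2^{-m} a, 10 · 2^{-m}) ⊆ Ω`, the integral of `‖fderiv ℝ v‖²` over the union of the half-open
squares `2^{-m}(a + [0,1)²)` is at most `I`. [cite: GeorgakopoulosPanagiotis2019, §4.5] -/
theorem lintegral_level_le' (hΩo : IsOpen Ω) {δs : ℕ → ℝ} (hδ : ∀ n, 0 < δs n)
    (hδ0 : Tendsto δs atTop (𝓝 0)) {G : ℕ → SimpleGraph (Site 2)} {h : ℕ → Site 2 → ℝ}
    (hedges : ∀ K' ⊆ Ω, IsCompact K' → ∀ᶠ n in atTop, ∀ x : Site 2, meshPoint (δs n) x ∈ K' →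
      ∀ i : Fin 2, s(x, x + (Pi.single i 1 : Site 2)) ∈ (G n).edgeSet)
    {C : ℕ → ℝ≥0∞} (hC : ∀ n, networkEnergy (G n) 1 (h n) ≤ C n)
    {I : ℝ≥0∞} (hI : Tendsto C atTop (𝓝 I)) {v : ℂ → ℝ} (hvc : ContinuousOn (fderiv ℝ v) Ω)
    (hD : ∀ i : Fin 2, TendstoLocallyUniformlyOn
      (fun n w => (h n (nearestSite (δs n) w + Pi.single i 1) - h n (nearestSite (δs n) w)) / δs n)
      (fun w => fderiv ℝ v w (if i = 0 then (1 : ℂ) else Complex.I)) atTop Ω)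
    (m : ℕ) (𝒬 : Finset (Site 2))
    (h𝒬 : ∀ a ∈ 𝒬, closedBall (meshPoint ((2 : ℝ)⁻¹ ^ m) a) (10 * (2 : ℝ)⁻¹ ^ m) ⊆ Ω) :
    ∫⁻ w in ⋃ a ∈ 𝒬, (Ico ((2 : ℝ)⁻¹ ^ m * a 0) ((2 : ℝ)⁻¹ ^ m * (a 0 + 1)) ×ℂ
        Ico ((2 : ℝ)⁻¹ ^ m * a 1) ((2 : ℝ)⁻¹ ^ m * (a 1 + 1))), ‖fderiv ℝ v w‖ₑ ^ 2 ≤ I := by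
  set ℓ : ℝ := (2 : ℝ)⁻¹ ^ m with hℓ
  have hℓ0 : 0 < ℓ := by positivity
  set Sq : Site 2 → Set ℂ := fun a => Ico (ℓ * a 0) (ℓ * (a 0 + 1)) ×ℂ Ico (ℓ * a 1) (ℓ * (a 1 + 1)) with hSq
  set K : Set ℂ := ⋃ a ∈ 𝒬, Sq a with hK
  -- the compact neighbourhood `K'`
  set K' : Set ℂ := ⋃ a ∈ 𝒬, closedBall (meshPoint ℓ a) (3 * ℓ) with hK'
  have hK'c : IsCompact K' := 𝒬.isCompact_biUnion fun a _ => isCompact_closedBall _ _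
  have hK'Ω : K' ⊆ Ω := by
    intro w hw
    obtain ⟨a, ha, hw⟩ := mem_iUnion₂.1 hw
    exact h𝒬 a ha (closedBall_subset_closedBall (by linarith) hw)
  have hnear : ∀ a ∈ 𝒬, ∀ w : ℂ, |w.re - ℓ * a 0| ≤ 3 * ℓ / 2 → |w.im - ℓ * a 1| ≤ 3 * ℓ / 2 → w ∈ K' := by
    intro a ha w h0 h1
    refine mem_iUnion₂.2 ⟨a, ha, ?_⟩
    rw [mem_closedBall, Complex.dist_eq]
    refine (Complex.norm_le_abs_re_add_abs_im _).trans ?_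
    simp only [Complex.sub_re, Complex.sub_im, meshPoint_re, meshPoint_im]
    linarith
  have hKK' : K ⊆ K' := by
    intro w hw
    obtain ⟨a, ha, ⟨hw0, hw0'⟩, ⟨hw1, hw1'⟩⟩ := mem_iUnion₂.1 hw
    refine hnear a ha w ?_ ?_
    · rw [abs_le]; constructor <;> linarith
    · rw [abs_le]; constructor <;> linarith
  -- a bound on the corners and on the integrand over `K'`
  obtain ⟨A, hA⟩ : ∃ A : ℕ, ∀ a ∈ 𝒬, |a 0| ≤ A ∧ |a 1| ≤ A := by
    obtain ⟨N, hN⟩ := Finset.exists_le (𝒬.image fun a => max (a 0).natAbs (a 1).natAbs)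
    refine ⟨N, fun a ha => ?_⟩
    have := hN _ (Finset.mem_image_of_mem _ ha)
    have h0 : (a 0).natAbs ≤ N := (le_max_left _ _).trans this
    have h1 : (a 1).natAbs ≤ N := (le_max_right _ _).trans this
    rw [Int.abs_eq_natAbs, Int.abs_eq_natAbs]
    exact ⟨by exact_mod_cast h0, by exact_mod_cast h1⟩
  obtain ⟨Cb₀, hCb₀⟩ := hK'c.exists_bound_of_continuousOn (hvc.mono hK'Ω)
  set Cb : ℝ := max Cb₀ 0 with hCbdef
  have hCb0 : 0 ≤ Cb := le_max_right _ _
  have hCb : ∀ w ∈ K', ‖fderiv ℝ v w‖ ≤ Cb := fun w hw => (hCb₀ w hw).trans (le_max_left _ _)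
  have hFb : ∀ w ∈ K', ‖fderiv ℝ v w‖ₑ ^ 2 ≤ ENNReal.ofReal (Cb ^ 2) := by
    intro w hw
    calc ‖fderiv ℝ v w‖ₑ ^ 2 = ENNReal.ofReal (‖fderiv ℝ v w‖ ^ 2) := by
          rw [← ofReal_norm, ENNReal.ofReal_pow (norm_nonneg _)]
      _ ≤ ENNReal.ofReal (Cb ^ 2) :=
          ENNReal.ofReal_le_ofReal (pow_le_pow_left₀ (norm_nonneg _) (hCb w hw) 2)
  -- the main estimate with three slack parameters
  have main : ∀ θ : ℝ, 0 < θ → ∀ η : ℝ, 0 < η → ∀ ε' : ℝ, 0 < ε' →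
      ∫⁻ w in K, ‖fderiv ℝ v w‖ₑ ^ 2 ≤
        ENNReal.ofReal (1 + θ) * I + ENNReal.ofReal (8 * (1 + θ⁻¹) * η ^ 2 * (ℓ ^ 2 * 𝒬.card)) +
          ENNReal.ofReal ε' := by
    intro θ hθ η hη ε' hε'
    obtain ⟨τ, hτ, hτuc⟩ := Metric.uniformContinuousOn_iff.1
      (hK'c.uniformContinuousOn_of_continuous (hvc.mono hK'Ω)) η hη
    have hunif : ∀ i : Fin 2, ∀ᶠ n in atTop, ∀ w ∈ K',
        |(h n (nearestSite (δs n) w + Pi.single i 1) - h n (nearestSite (δs n) w)) /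
            δs n - fderiv ℝ v w (if i = 0 then (1 : ℂ) else Complex.I)| ≤ η := by
      intro i
      have hu := (tendstoLocallyUniformlyOn_iff_forall_isCompact hΩo).1 (hD i) K' hK'Ω hK'c
      refine ((Metric.tendstoUniformlyOn_iff.1 hu) η hη).mono fun n hn w hw => ?_
      have := hn w hw
      rw [Real.dist_eq, abs_sub_comm] at this
      exact this.le
    -- the threshold on the mesh
    set Mε : ℝ := Cb ^ 2 * (𝒬.card * (8 * ℓ * (A + 1))) with hMε
    have hMε0 : 0 ≤ Mε := by positivity
    have hmesh : ∀ᶠ n in atTop, δs n < τ / 2 ∧ δs n * (A + 1) ≤ ℓ / 2 ∧ Mε * δs n ≤ ε' := by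
      have h1 : ∀ᶠ n in atTop, δs n < τ / 2 := (tendsto_order.1 hδ0).2 _ (half_pos hτ)
      have h2 : ∀ᶠ n in atTop, δs n < ℓ / 2 / (A + 1) := (tendsto_order.1 hδ0).2 _ (by positivity)
      have h3 : ∀ᶠ n in atTop, δs n < ε' / (Mε + 1) := (tendsto_order.1 hδ0).2 _ (by positivity)
      filter_upwards [h1, h2, h3] with n hn1 hn2 hn3
      refine ⟨hn1, ?_, ?_⟩
      · rw [lt_div_iff₀ (by positivity)] at hn2; exact hn2.le
      · rw [lt_div_iff₀ (by positivity)] at hn3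
        linarith [(hδ n).le]
    have hev : ∀ᶠ n in atTop, ∫⁻ w in K, ‖fderiv ℝ v w‖ₑ ^ 2 ≤
        ENNReal.ofReal (1 + θ) * C n + ENNReal.ofReal (8 * (1 + θ⁻¹) * η ^ 2 * (ℓ ^ 2 * 𝒬.card)) +
          ENNReal.ofReal ε' := by
      filter_upwards [hunif 0, hunif 1, hmesh, hedges K' hK'Ω hK'c] with n hn0 hn1 hn2 hn3
      obtain ⟨hδτ', hδA, hδε⟩ := hn2
      set δ : ℝ := δs n with hδdef
      have hδp : 0 < δ := hδ n
      have hδτ : 2 * δ < τ := by linarith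
      have hδApos : 0 ≤ δ * A := by positivity
      have hδA' : δ * A ≤ ℓ / 2 := by linarith
      have hδℓ : δ ≤ ℓ / 2 := by linarith
      -- the fine side `δ P`, `P = ⌊ℓ / δ⌋`
      set P : ℕ := ⌊ℓ / δ⌋₊ with hPdef
      have hPle : (P : ℝ) ≤ ℓ / δ := Nat.floor_le (by positivity)
      have hPge : ℓ / δ - 1 < P := Nat.sub_one_lt_floor _
      have hδP : δ * P ≤ ℓ := by rwa [le_div_iff₀ hδp, mul_comm] at hPle
      have hδP' : ℓ - δ < δ * P := by
        have := sub_lt_iff_lt_add.1 hPge; rw [div_lt_iff₀ hδp] at this; linarith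
      have hP : 0 < P := Nat.floor_pos.2 (by rw [le_div_iff₀ hδp]; linarith)
      -- drift of the fine corners: `|δ P aᵢ - ℓ aᵢ| ≤ δ A`
      have hdrift : ∀ a ∈ 𝒬, ∀ i : Fin 2, |δ * P * a i - ℓ * a i| ≤ δ * A := by
        intro a ha i
        have hai : |((a i : ℤ) : ℝ)| ≤ A := by
          have : |a i| ≤ (A : ℤ) := by fin_cases i; exacts [(hA a ha).1, (hA a ha).2]
          exact_mod_cast this
        rw [show δ * P * a i - ℓ * a i = -((ℓ - δ * P) * a i) by ring, abs_neg, abs_mul,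
          abs_of_nonneg (by linarith)]
        calc (ℓ - δ * P) * |((a i : ℤ) : ℝ)| ≤ δ * |((a i : ℤ) : ℝ)| := by gcongr; linarith
          _ ≤ δ * A := by gcongr
      -- lattice points of the grids have nearby points in `K'`
      have hgridK' : ∀ a ∈ 𝒬, ∀ p ∈ Finset.Ico (a 0 * P) (a 0 * P + P) ×ˢ Finset.Ico (a 1 * P) (a 1 * P + P),
          ∀ w : ℂ, |w.re - δ * p.1| ≤ δ → |w.im - δ * p.2| ≤ δ → w ∈ K' := by
        intro a ha p hp w h0 h1
        obtain ⟨hp0, hp1⟩ := Finset.mem_product.1 hp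
        rw [Finset.mem_Ico] at hp0 hp1
        have d0 := hdrift a ha 0
        have d1 := hdrift a ha 1
        rw [abs_le] at d0 d1
        have c0 : δ * P * a 0 ≤ δ * p.1 ∧ δ * p.1 ≤ δ * P * a 0 + (δ * P - δ) := by
          have e0 : δ * P * a 0 = δ * ((a 0 * P : ℤ) : ℝ) := by push_cast; ring
          rw [e0]
          constructor
          · exact mul_le_mul_of_nonneg_left (by exact_mod_cast hp0.1) hδp.le
          · have : (p.1 : ℝ) ≤ (a 0 * P : ℤ) + P - 1 := by
              have : p.1 ≤ a 0 * P + P - 1 := by omega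
              exact_mod_cast this
            have := mul_le_mul_of_nonneg_left this hδp.le
            linarith
        have c1 : δ * P * a 1 ≤ δ * p.2 ∧ δ * p.2 ≤ δ * P * a 1 + (δ * P - δ) := by
          have e1 : δ * P * a 1 = δ * ((a 1 * P : ℤ) : ℝ) := by push_cast; ring
          rw [e1]
          constructor
          · exact mul_le_mul_of_nonneg_left (by exact_mod_cast hp1.1) hδp.le
          · have : (p.2 : ℝ) ≤ (a 1 * P : ℤ) + P - 1 := by
              have : p.2 ≤ a 1 * P + P - 1 := by omega
              exact_mod_cast this
            have := mul_le_mul_of_nonneg_left this hδp.le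
            linarith
        refine hnear a ha w ?_ ?_
        · rw [abs_le] at h0 ⊢; constructor <;> linarith [c0.1, c0.2, d0.1, d0.2]
        · rw [abs_le] at h1 ⊢; constructor <;> linarith [c1.1, c1.2, d1.1, d1.2]
      -- the cellwise bound
      have hcellb : ∀ a ∈ 𝒬, ∀ p ∈ Finset.Ico (a 0 * P) (a 0 * P + P) ×ˢ Finset.Ico (a 1 * P) (a 1 * P + P),
          ∀ w ∈ Ico (δ * p.1) (δ * (p.1 + 1)) ×ℂ Ico (δ * p.2) (δ * (p.2 + 1)),
            ‖fderiv ℝ v w‖ₑ ^ 2 ≤ ENNReal.ofReal ((1 + θ) * (((h n (![p.1, p.2] + Pi.single 0 1) - h n ![p.1, p.2]) ^ 2 +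
              (h n (![p.1, p.2] + Pi.single 1 1) - h n ![p.1, p.2]) ^ 2) / δ ^ 2) + 8 * (1 + θ⁻¹) * η ^ 2) := by
        intro a ha p hp w hw
        set x : Site 2 := ![p.1, p.2] with hx
        have hmx : meshPoint δ x = ⟨δ * p.1, δ * p.2⟩ := Complex.ext (by simp [hx]) (by simp [hx])
        have hxK' : meshPoint δ x ∈ K' :=
          hgridK' a ha p hp _ (by rw [hmx]; simp [hδp.le]) (by rw [hmx]; simp [hδp.le])
        obtain ⟨⟨hw0, hw0'⟩, ⟨hw1, hw1'⟩⟩ := hw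
        have hwK' : w ∈ K' := hgridK' a ha p hp w (by rw [abs_le]; constructor <;> linarith)
          (by rw [abs_le]; constructor <;> linarith)
        have hdist : dist w (meshPoint δ x) < τ := by
          rw [Complex.dist_eq, hmx]
          refine (Complex.norm_le_abs_re_add_abs_im _).trans_lt ?_
          have e0 : |w.re - δ * p.1| ≤ δ := by rw [abs_le]; constructor <;> linarith
          have e1 : |w.im - δ * p.2| ≤ δ := by rw [abs_le]; constructor <;> linarith
          simp only [Complex.sub_re, Complex.sub_im]
          linarith
        have hg : ‖fderiv ℝ v w - fderiv ℝ v (meshPoint δ x)‖ ≤ η := by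
          rw [← dist_eq_norm]; exact (hτuc w hwK' _ hxK' hdist).le
        have h0' := hn0 (meshPoint δ x) hxK'
        have h1' := hn1 (meshPoint δ x) hxK'
        rw [nearestSite_meshPoint hδp.ne'] at h0' h1'
        simp only [Fin.isValue, ↓reduceIte, show (1 : Fin 2) ≠ 0 from by decide] at h0' h1'
        have key := norm_sq_le_of_close (fderiv ℝ v w) (fderiv ℝ v (meshPoint δ x)) hθ h0' h1' hg
        calc ‖fderiv ℝ v w‖ₑ ^ 2 = ENNReal.ofReal (‖fderiv ℝ v w‖ ^ 2) := by
              rw [← ofReal_norm, ENNReal.ofReal_pow (norm_nonneg _)]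
          _ ≤ _ := ENNReal.ofReal_le_ofReal key
      have hedges' : ∀ a ∈ 𝒬, ∀ p ∈ Finset.Ico (a 0 * P) (a 0 * P + P) ×ˢ Finset.Ico (a 1 * P) (a 1 * P + P),
          ∀ i : Fin 2, s((![p.1, p.2] : Site 2), ![p.1, p.2] + Pi.single i 1) ∈ (G n).edgeSet := by
        intro a ha p hp i
        refine hn3 _ (hgridK' a ha p hp _ ?_ ?_) i
        · have : meshPoint δ ![p.1, p.2] = ⟨δ * p.1, δ * p.2⟩ := Complex.ext (by simp) (by simp)
          rw [this]; simp [hδp.le]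
        · have : meshPoint δ ![p.1, p.2] = ⟨δ * p.1, δ * p.2⟩ := Complex.ext (by simp) (by simp)
          rw [this]; simp [hδp.le]
      have core := lintegral_squares_le_energy hδp hP 𝒬 (G n) (h n) (F := fun w => ‖fderiv ℝ v w‖ₑ ^ 2)
        hθ hcellb hedges'
      -- the fine squares and the leftover frame
      set FS : Site 2 → Set ℂ := fun a =>
        Ico (δ * P * a 0) (δ * P * (a 0 + 1)) ×ℂ Ico (δ * P * a 1) (δ * P * (a 1 + 1)) with hFS
      have hleft : K \ (⋃ a ∈ 𝒬, FS a) ⊆ ⋃ a ∈ 𝒬, (Sq a \ FS a) := by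
        rintro w ⟨hwK, hwn⟩
        obtain ⟨a, ha, hwa⟩ := mem_iUnion₂.1 hwK
        exact mem_iUnion₂.2 ⟨a, ha, hwa, fun h' => hwn (mem_iUnion₂.2 ⟨a, ha, h'⟩)⟩
      have hframe : ∀ a ∈ 𝒬, volume (Sq a \ FS a) ≤ ENNReal.ofReal (8 * (δ * (A + 1)) * ℓ) := by
        intro a ha
        have d0 := hdrift a ha 0
        have d1 := hdrift a ha 1
        rw [abs_le] at d0 d1
        have e : ∀ i : Fin 2, δ * P * ((a i : ℝ) + 1) = δ * P * a i + δ * P := fun i => by ring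
        simp only [hSq, hFS, Fin.isValue]
        rw [show ℓ * ((a 0 : ℝ) + 1) = ℓ * a 0 + ℓ by ring, show ℓ * ((a 1 : ℝ) + 1) = ℓ * a 1 + ℓ by ring,
          e 0, e 1]
        refine volume_sq_diff_sq_le hℓ0.le (by positivity) ?_ ?_ ?_ ?_ ?_
        · linarith [d0.1]
        · linarith [d0.2]
        · linarith [d1.1]
        · linarith [d1.2]
        · linarith
      have hleftvol : volume (K \ ⋃ a ∈ 𝒬, FS a) ≤ 𝒬.card * ENNReal.ofReal (8 * (δ * (A + 1)) * ℓ) := by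
        calc volume (K \ ⋃ a ∈ 𝒬, FS a) ≤ volume (⋃ a ∈ 𝒬, (Sq a \ FS a)) := measure_mono hleft
          _ ≤ ∑ a ∈ 𝒬, volume (Sq a \ FS a) := measure_biUnion_finset_le _ _
          _ ≤ ∑ a ∈ 𝒬, ENNReal.ofReal (8 * (δ * (A + 1)) * ℓ) := Finset.sum_le_sum hframe
          _ = 𝒬.card * ENNReal.ofReal (8 * (δ * (A + 1)) * ℓ) := by rw [Finset.sum_const, nsmul_eq_mul]
      have hleftint : ∫⁻ w in K \ ⋃ a ∈ 𝒬, FS a, ‖fderiv ℝ v w‖ₑ ^ 2 ≤ ENNReal.ofReal ε' := by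
        calc ∫⁻ w in K \ ⋃ a ∈ 𝒬, FS a, ‖fderiv ℝ v w‖ₑ ^ 2
            ≤ ∫⁻ w in K \ ⋃ a ∈ 𝒬, FS a, ENNReal.ofReal (Cb ^ 2) :=
              setLIntegral_mono measurable_const fun w hw => hFb w (hKK' hw.1)
          _ = ENNReal.ofReal (Cb ^ 2) * volume (K \ ⋃ a ∈ 𝒬, FS a) := setLIntegral_const _ _
          _ ≤ ENNReal.ofReal (Cb ^ 2) * (𝒬.card * ENNReal.ofReal (8 * (δ * (A + 1)) * ℓ)) := by gcongr
          _ = ENNReal.ofReal (Mε * δ) := by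
              rw [hMε, ← ENNReal.ofReal_natCast, ← ENNReal.ofReal_mul (by positivity),
                ← ENNReal.ofReal_mul (by positivity)]
              congr 1; ring
          _ ≤ ENNReal.ofReal ε' := ENNReal.ofReal_le_ofReal hδε
      calc ∫⁻ w in K, ‖fderiv ℝ v w‖ₑ ^ 2
          ≤ ∫⁻ w in (⋃ a ∈ 𝒬, FS a) ∪ (K \ ⋃ a ∈ 𝒬, FS a), ‖fderiv ℝ v w‖ₑ ^ 2 :=
            lintegral_mono_set fun w hw => by
              by_cases h' : w ∈ ⋃ a ∈ 𝒬, FS a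
              · exact Or.inl h'
              · exact Or.inr ⟨hw, h'⟩
        _ ≤ (∫⁻ w in ⋃ a ∈ 𝒬, FS a, ‖fderiv ℝ v w‖ₑ ^ 2) + ∫⁻ w in K \ ⋃ a ∈ 𝒬, FS a, ‖fderiv ℝ v w‖ₑ ^ 2 :=
            lintegral_union_le _ _ _
        _ ≤ (ENNReal.ofReal (1 + θ) * networkEnergy (G n) 1 (h n) +
              ENNReal.ofReal (8 * (1 + θ⁻¹) * η ^ 2 * ((δ * P) ^ 2 * 𝒬.card))) + ENNReal.ofReal ε' :=
            add_le_add core hleftint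
        _ ≤ _ := by
            have h1 : ENNReal.ofReal (1 + θ) * networkEnergy (G n) 1 (h n) ≤ ENNReal.ofReal (1 + θ) * C n :=
              mul_le_mul_of_nonneg_left (hC n) bot_le
            have h2 : ENNReal.ofReal (8 * (1 + θ⁻¹) * η ^ 2 * ((δ * P) ^ 2 * 𝒬.card)) ≤
                ENNReal.ofReal (8 * (1 + θ⁻¹) * η ^ 2 * (ℓ ^ 2 * 𝒬.card)) := by
              refine ENNReal.ofReal_le_ofReal ?_
              have hsq : (δ * P) ^ 2 ≤ ℓ ^ 2 := pow_le_pow_left₀ (by positivity) hδP 2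
              have h8 : 0 ≤ 8 * (1 + θ⁻¹) * η ^ 2 := by positivity
              have hc : (0 : ℝ) ≤ 𝒬.card := by positivity
              exact mul_le_mul_of_nonneg_left (mul_le_mul_of_nonneg_right hsq hc) h8
            exact add_le_add (add_le_add h1 h2) le_rfl
    have hlim : Tendsto (fun n => ENNReal.ofReal (1 + θ) * C n +
        ENNReal.ofReal (8 * (1 + θ⁻¹) * η ^ 2 * (ℓ ^ 2 * 𝒬.card)) + ENNReal.ofReal ε') atTop
        (𝓝 (ENNReal.ofReal (1 + θ) * I + ENNReal.ofReal (8 * (1 + θ⁻¹) * η ^ 2 * (ℓ ^ 2 * 𝒬.card)) +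
          ENNReal.ofReal ε')) :=
      ((ENNReal.Tendsto.const_mul hI (Or.inr ENNReal.ofReal_ne_top)).add tendsto_const_nhds).add
        tendsto_const_nhds
    exact ge_of_tendsto hlim hev
  -- let `ε' → 0`, `η → 0`, then `θ → 0`
  by_cases hItop : I = ⊤
  · rw [hItop]; exact le_top
  have step1 : ∀ θ : ℝ, 0 < θ → ∫⁻ w in K, ‖fderiv ℝ v w‖ₑ ^ 2 ≤ ENNReal.ofReal (1 + θ) * I := by
    intro θ hθ
    refine ENNReal.le_of_forall_pos_le_add fun ε hε _ => ?_
    -- choose `η` with `8(1+θ⁻¹) η² ℓ² |𝒬| ≤ ε / 2`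
    set M : ℝ := 8 * (1 + θ⁻¹) * (ℓ ^ 2 * 𝒬.card) with hM
    have hM0 : 0 ≤ M := by positivity
    set η : ℝ := Real.sqrt ((ε : ℝ) / 2 / (M + 1)) with hη
    have hε2 : (0 : ℝ) < (ε : ℝ) / 2 := by positivity
    have hη0 : 0 < η := Real.sqrt_pos.2 (by positivity)
    have hηsq : η ^ 2 = (ε : ℝ) / 2 / (M + 1) := Real.sq_sqrt (by positivity)
    have hbound : 8 * (1 + θ⁻¹) * η ^ 2 * (ℓ ^ 2 * 𝒬.card) ≤ ε / 2 := by
      rw [show 8 * (1 + θ⁻¹) * η ^ 2 * (ℓ ^ 2 * 𝒬.card) = M * η ^ 2 by rw [hM]; ring, hηsq]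
      rw [mul_div_assoc']
      rw [div_le_iff₀ (by positivity)]
      nlinarith [NNReal.coe_nonneg ε]
    calc ∫⁻ w in K, ‖fderiv ℝ v w‖ₑ ^ 2
        ≤ ENNReal.ofReal (1 + θ) * I + ENNReal.ofReal (8 * (1 + θ⁻¹) * η ^ 2 * (ℓ ^ 2 * 𝒬.card)) +
            ENNReal.ofReal (ε / 2) := main θ hθ η hη0 (ε / 2) hε2
      _ ≤ ENNReal.ofReal (1 + θ) * I + ENNReal.ofReal (ε / 2) + ENNReal.ofReal (ε / 2) := by
          gcongr
      _ = ENNReal.ofReal (1 + θ) * I + ε := by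
          rw [add_assoc, ← ENNReal.ofReal_add hε2.le hε2.le, add_halves, ENNReal.ofReal_coe_nnreal]
  refine ENNReal.le_of_forall_pos_le_add fun ε hε _ => ?_
  -- choose `θ` with `θ I ≤ ε`
  have hIr : I.toReal < I.toReal + 1 := by linarith
  set θ : ℝ := (ε : ℝ) / (I.toReal + 1) with hθ
  have hθ0 : 0 < θ := by positivity
  calc ∫⁻ w in K, ‖fderiv ℝ v w‖ₑ ^ 2 ≤ ENNReal.ofReal (1 + θ) * I := step1 θ hθ0
    _ = I + ENNReal.ofReal θ * I := by
        rw [ENNReal.ofReal_add zero_le_one hθ0.le, ENNReal.ofReal_one, add_mul, one_mul]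
    _ ≤ I + ε := by
        gcongr
        rw [← ENNReal.ofReal_toReal hItop, ← ENNReal.ofReal_mul hθ0.le, ← ENNReal.ofReal_coe_nnreal]
        refine ENNReal.ofReal_le_ofReal ?_
        rw [hθ, div_mul_eq_mul_div, div_le_iff₀ (by positivity)]
        nlinarith [NNReal.coe_nonneg ε, ENNReal.toReal_nonneg (a := I)]

end KirchhoffSlope

end Summit.CriticalPhenomena.CardyFormulaZ2.Theorems
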